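import Summits.QuantumFields.YangMills.Theorems.LangevinControlUVOSLegsAtWeakCouplingCSketchConditional
import Summits.QuantumFields.YangMills.Theorems.LangevinControlUVOSLegsAtWeakCouplingCStubRope
import Summits.QuantumFields.YangMills.Theorems.LangevinControlUVOSLegsFromFemtoAndGapStubHypercubic
import HarnessLib

/-!
# Crux `OSLegsAtWeakCouplingC` (stmt-QuantumFields-16207), line `Sketch`: the crux from the line's two imports

Support file (lead c2): with `stub_rope` (…Theorems.LangevinControlUVOSLegsAtWeakCouplingCStubRope, p133794) and
`stub_hypercubic` (…Theorems.LangevinControlUVOSLegsFromFemtoAndGapStubHypercubic, landed by the predecessor line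
dlr-collar-transfer r3, p115564) in the tree, the landed conditional composition `osLegsAtWeakCouplingC_of_imports`
(…SketchConditional, p132819) specialises to the line's terminal statement: `OSLegsAtWeakCouplingC` BY NAME from the
two declared dynamical IMPORTS of line `Sketch`,

* `Statement.stub_fcp6` — the frozen-boundary femto package `FBL6 ∧ FC2 ∧ FC3` from the pinned periodic packages
  (engine-grade; card `Cruxes/OSLegsFromFemtoAndGap/Lines/dlr-collar-transfer.md`), and
* `Statement.stub_germ` — E1 on the germ at the origin along weak-coupling soft bundles (dynamical; card
  `Cruxes/OSLegsAtWeakCouplingC/Ideas/axis-cross-analyticity-e1-locality.md` §3; barrier RegularisationDichotomy).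

Everything else — the soft legs, the lattice reflection-positivity rope, the hypercubic symmetries, E1-locality, the
OS axioms of the limit, the extension by zero and all clauses of `ConclC` — is proved in the tree.  This is a
CONDITIONAL result by design: the crux item stays open until the two imports are settled.
-/

set_option autoImplicit false

noncomputable section

open Summit.QuantumFields.YangMills.Theses.LangevinControlUV (OSLegsAtWeakCouplingC)
open Summit.QuantumFields.YangMills.Cruxes.OSLegsFromFemtoAndGap.DlrCollarTransfer

namespace Summit.QuantumFields.YangMills.Cruxes.OSLegsAtWeakCouplingC.Sketch

/-- **The crux from the line's two imports** (conditional result): `OSLegsAtWeakCouplingC` BY NAME from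
`stub_fcp6` and `stub_germ`; `stub_rope` and `stub_hypercubic` are discharged by the landed theorems. -/
theorem osLegsAtWeakCouplingC_of_fcp6_germ (hfcp : Statement.stub_fcp6) (hgerm : Statement.stub_germ) : OSLegsAtWeakCouplingC :=
  osLegsAtWeakCouplingC_of_imports hfcp stub_rope stub_hypercubic hgerm

end Summit.QuantumFields.YangMills.Cruxes.OSLegsAtWeakCouplingC.Sketch

end
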